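import Summits.HodgeConjecture.HodgeConjecture.Theorems.R90S3PlantedDenseCMOdd   -- ★ odd half (this seat): `plantedDenseCM_of_odd`
import Summits.HodgeConjecture.HodgeConjecture.Theorems.R90S3PlantedDenseCMTwo   -- ★ dyadic half (this seat): `plantedDenseCM_of_two`
import HarnessLib

/-!
# R90-TF · S3 · THEOREMS — `R90S3PlantedDenseCM` ((U3-F) assembly, THE B-TARGET): at every non-split finite place `v` of `L⁺`, a CM number field `L′` with a dense
# conjugation-equivariant embedding `L′ → L_w`, `[L′⁺ : ℚ] ≥ 3`, and `L′ ∕ L′⁺` unramified off the place cut out by the embedding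

R90-TF section S3 (captain K2E3-p17 (g11) of the (U3-F) socket `stub_R90_S3_auxGlobaliseField`, `Cruxes/H413/Lines/R90_S3_LocalTransportWaveG.lean`); crux H413
(`stmt-HodgeConjecture-24833`, lane `--supports … --as helper`), route `HCCMUnconditional`.  STATEMENT = the B-TARGET FROZEN by R90-C12-typ2 (g4) 2026-09-05T01:21:48Z
(bytes = ★ p864027 `auxGlobaliseField_of_exists_place_denseCM`'s `hex` :106–:113 + the socket's `hv` binder; plug shape kernel-certified, AUDIT S3#90): the G plug of
record (ED. 6, S3 pen) is `stub_R90_S3_auxGlobaliseField … hv := by exact auxGlobaliseField_of_exists_place_denseCM L v (plantedDenseCM L v hv)`.  PROOF = the residue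
characteristic `p` of `v` (§1) and the two halves ★ `plantedDenseCM_of_two` (`p = 2`) ∕ ★ `plantedDenseCM_of_odd` (`p ≠ 2`).  THEOREMS ONLY (no `def`, no `instance`,
no notation, no named fact, no `sorry`); ★ imports only; never imports `Cruxes/…/Lines`.
* §1 `exists_prime_natCast_mem` — every finite place of a number field lies over a rational prime (the characteristic of its finite residue field).
* §2 **`plantedDenseCM`** — the frozen (U3-F) B-target.

HONEST LABEL: HC_CM is proved only modulo the 7 printed citations (2 remaining named inputs: hLiu418 = stmt-HodgeConjecture-24832, h413 =
stmt-HodgeConjecture-24833) until rung 0 closes; this file pays the B-target of the GENUINE residual (U3-F) — the socket itself closes only when G's ED. 6 plug is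
WRITTEN and BUILT; proves nothing printed; count-neutral.

## References
* [Rogawski1990] J. D. Rogawski, *Automorphic Representations of Unitary Groups in Three Variables* (1990), §13.8 pp. 212–216.
* [CasselsFrohlichANT1967] J. W. S. Cassels, A. Fröhlich (eds.), *Algebraic Number Theory* (1967), Ch. II §10.
* [NeukirchANT1999] J. Neukirch, *Algebraic Number Theory* (1999), Ch. I §8 Prop. (8.3), Ch. II (8.2)–(8.5).
-/

set_option autoImplicit false
-- the mandated namespace repeats the single-problem summit's segment (`HodgeConjecture.HodgeConjecture`)
set_option linter.dupNamespace false

noncomputable section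

open IsDedekindDomain NumberField Topology
open Literature.NumberTheory.Automorphic Literature.NumberTheory.Automorphic.UnitaryGroup

namespace Summit.HodgeConjecture.HodgeConjecture.R90.S3

/-! ## §1 The residue characteristic of a finite place -/

/-- Every finite place `v` of a number field `F` lies over a rational prime `p` (`p ∈ 𝔭_v`: the characteristic of the finite residue field `𝓞 F ⧸ 𝔭_v`).
[cite: NeukirchANT1999, Ch. I §8 Prop. (8.3)] -/
theorem exists_prime_natCast_mem {F : Type} [Field F] [NumberField F] (v : HeightOneSpectrum (𝓞 F)) :
    ∃ p : ℕ, p.Prime ∧ ((p : ℕ) : 𝓞 F) ∈ v.asIdeal := by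
  -- adapted from `Literature.AnabelianGeometry.AbsoluteAnabelian.NFDecompositionRelSlimProofs.exists_prime_natCast_mem_asIdeal` (same argument)
  haveI : v.asIdeal.IsPrime := v.isPrime
  haveI : Finite (𝓞 F ⧸ v.asIdeal) := Ideal.finiteQuotientOfFreeOfNeBot v.asIdeal v.ne_bot
  obtain ⟨q, hq⟩ := CharP.exists (𝓞 F ⧸ v.asIdeal)
  have hqprime : q.Prime := (CharP.char_is_prime_or_zero (𝓞 F ⧸ v.asIdeal) q).resolve_right
    (CharP.char_ne_zero_of_finite (𝓞 F ⧸ v.asIdeal) q)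
  refine ⟨q, hqprime, ?_⟩
  rw [← Ideal.Quotient.eq_zero_iff_mem, map_natCast]
  exact CharP.cast_eq_zero _ q

/-! ## §2 The B-target -/

variable (L : Type) [Field L] [NumberField L] [IsCMField L] (v : HeightOneSpectrum (𝓞 ↥(maximalRealSubfield L)))

/-- **THE PLANTED DENSE CM DATUM (the frozen (U3-F) B-target).**  At a finite place `v` of `L⁺` that does not split in the CM field `L` (every `w ∣ v` is fixed by
complex conjugation): a place `w ∣ v` fixed by complex conjugation, a CM number field `L′`, a ring homomorphism `J : L′ →+* L_w` with dense image intertwining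
the complex conjugations, `3 ≤ [L′⁺ : ℚ]`, and «`L′ ∕ L′⁺` is unramified at every finite place `w′` of `L′⁺` other than the one cut out by `J`» — Rogawski's
«choose `E∕F` and `w` such that `E_w∕F_w` is isomorphic to `E′∕F′` and `E∕F` is a CM field», by planting a polynomial (★ `plantedDenseCM_of_odd`,
★ `plantedDenseCM_of_two`). [cite: Rogawski1990, §13.8 p. 216] [cite: CasselsFrohlichANT1967, Ch. II §10] [cite: NeukirchANT1999, Ch. II (8.2)-(8.5)] -/
theorem plantedDenseCM (hv : ∀ w : UnitaryGroup.PlacesOver L v, IsCMField.complexConj L • w.1 = w.1) :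
    ∃ (w : PlacesOver L v) (hw : IsCMField.complexConj L • w.1 = w.1)
      (L' : Type) (_ : Field L') (_ : NumberField L') (_ : IsCMField L') (J : L' →+* w.1.adicCompletion L),
        DenseRange J ∧
        (∀ x : L', J (IsCMField.complexConj L' x) = galAdicCompletionMap (L := L) (IsCMField.complexConj L) hw (J x)) ∧
        3 ≤ Module.finrank ℚ ↥(maximalRealSubfield L') ∧
        (∀ w' : HeightOneSpectrum (𝓞 ↥(maximalRealSubfield L')),
          (¬ ∀ x : 𝓞 ↥(maximalRealSubfield L'), x ∈ w'.asIdeal ↔ Valued.v (J (algebraMap ↥(maximalRealSubfield L') L' x)) < 1) →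
          ∀ W : PlacesOver L' w', Algebra.IsUnramifiedAt (𝓞 ↥(maximalRealSubfield L')) W.1.asIdeal) := by
  obtain ⟨p, hp, hvp⟩ := exists_prime_natCast_mem v
  haveI : Fact p.Prime := ⟨hp⟩
  by_cases hp2 : p = 2
  · subst hp2
    exact plantedDenseCM_of_two L v hv hvp
  · exact plantedDenseCM_of_odd L v hv hp2 hvp

end Summit.HodgeConjecture.HodgeConjecture.R90.S3

end
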